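import Summits.Ventures.YMGap.Thresholds.StrongCouplingLoopResampling
import HarnessLib

/-!
# Corner and strip geometry of rectangular loops in `ℤ^d`: which plaquettes hold two or three links of a loop, and the resulting
# plaquette-covering numbers `2(R+T) − 4` (both sides `≥ 2`) and `R + T − 1` (thin loops) (row type C-PERIMETER-G, geometry)

Cell `pub-ymgap`, seat ds-1 (gen 16). HONEST FRAMING: elementary LATTICE combinatorics of the `R × T` rectangular loop in the `(i, j)` plane of `ℤ^d`
(no measure theory, no gauge group), feeding the covering hypothesis of the universal strong-coupling bound (`StrongCouplingCoveringBound`,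
`StrongCouplingPerimeterLawAllGroups`). Nothing about weak coupling, the continuum, or the Clay problem. Kernel theorems only, 0 definitions, 0 compute.

* `coords_of_mem_loopEdges'` (coordinates of a loop link, including the running one), ★ `base_mem_corners_of_two_links` (an `i`-link and a `j`-link
  of the loop spanning one unit square pin it to one of the four INNER CORNERS), `loopEdges_comm` (`loopEdges x i j R T = loopEdges x j i T R`).
* both sides `≥ 2`: ★ `mem_corners_of_two_le_card` (a plaquette holding two loop links is an inner corner plaquette), ★ `exists_mem_loopEdges_forall_not_mem_corners`
  (`k + 4 < 2(R+T)` plaquettes leave a loop link uncovered — they cover at most `k + 4` links).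
* thin loops (`R = 1` or `T = 1`, not both): `card_plaquetteEdges_inter_loopEdges_le_three`, ★ `mem_corners_of_three_le_card`,
  ★ `exists_mem_loopEdges_forall_not_mem_thin` (`k + 1 < R + T` plaquettes leave a loop link uncovered: the corners collapse to the two strip ends).

References: K. Wilson, PRD 10 (1974) 2445 (loops and plaquette surfaces); E. Seiler, LNP 159 (1982), Ch. 2. -/

noncomputable section

open Set Finset
open Literature.MathematicalPhysics.QuantumLattice (ZdEdge ZdPlaquette plaquetteEdges)
open Literature.MathematicalPhysics.QuantumFieldTheory hiding ZdEdge
open Literature.MathematicalPhysics.QuantumFieldTheory.AreaLaw (loopEdges lineEdges mem_lineEdges_iff)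

namespace Summit.Ventures.YMGap.ZeroCouplingSlope

section Geometry

variable {d : ℕ}


/-- **Coordinates of the loop's links, with the running coordinate**: an `i`-link `(z, i)` of the `R × T` loop has `z l = x l` off `{i, j}`,
`z j ∈ {x j, x j + T}` and `x i ≤ z i ≤ x i + R − 1`; a `j`-link `(z, j)` has `z i ∈ {x i, x i + R}` and `x j ≤ z j ≤ x j + T − 1`. [folklore] -/
theorem coords_of_mem_loopEdges' {x z : Literature.Probability.LatticeModels.Site d} {i j κ : Fin d} (hij : i ≠ j) {R T : ℕ}
    (h : (z, κ) ∈ loopEdges x i j R T) :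
    (κ = i ∧ (∀ l, l ≠ i → l ≠ j → z l = x l) ∧ (z j = x j ∨ z j = x j + T) ∧ x i ≤ z i ∧ z i + 1 ≤ x i + R) ∨
      (κ = j ∧ (∀ l, l ≠ i → l ≠ j → z l = x l) ∧ (z i = x i ∨ z i = x i + R) ∧ x j ≤ z j ∧ z j + 1 ≤ x j + T) := by
  simp only [loopEdges, Finset.mem_union] at h
  rcases h with ((h | h) | h) | h
  · obtain ⟨t, ht, ht'⟩ := mem_lineEdges_iff.1 h
    simp only [Prod.mk.injEq] at ht'
    obtain ⟨hz, hκ⟩ := ht'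
    subst hz
    refine Or.inl ⟨hκ, fun l hl _ => by simp [hl], Or.inl (by simp [hij.symm]), by simp, ?_⟩
    simp; omega
  · obtain ⟨t, ht, ht'⟩ := mem_lineEdges_iff.1 h
    simp only [Prod.mk.injEq] at ht'
    obtain ⟨hz, hκ⟩ := ht'
    subst hz
    refine Or.inr ⟨hκ, fun l hl hl' => by simp [hl, hl'], Or.inr (by simp [hij]), by simp [hij], ?_⟩
    simp [hij]; omega
  · obtain ⟨t, ht, ht'⟩ := mem_lineEdges_iff.1 h
    simp only [Prod.mk.injEq] at ht'
    obtain ⟨hz, hκ⟩ := ht'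
    subst hz
    refine Or.inl ⟨hκ, fun l hl hl' => by simp [hl, hl'], Or.inr (by simp [hij.symm]), by simp [hij.symm], ?_⟩
    simp [hij.symm]; omega
  · obtain ⟨t, ht, ht'⟩ := mem_lineEdges_iff.1 h
    simp only [Prod.mk.injEq] at ht'
    obtain ⟨hz, hκ⟩ := ht'
    subst hz
    refine Or.inr ⟨hκ, fun l _ hl' => by simp [hl'], Or.inl (by simp [hij]), by simp, ?_⟩
    simp; omega

/-- ★ **An `i`-link and a `j`-link of the loop forming two sides of one unit square pin the square down to a corner.** If `i < j`
and the plaquette `q` (plane `(k, l)`, base `y`) has a `k`-link AND an `l`-link on the `R × T` loop in the `(i, j)` plane at `x`,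
then `(k, l) = (i, j)` and `y` is one of the four inner corners `x`, `x + (R−1)e_i`, `x + (T−1)e_j`, `x + (R−1)e_i + (T−1)e_j`. [folklore] -/
theorem base_mem_corners_of_two_links {x y : Literature.Probability.LatticeModels.Site d} {i j k l : Fin d} (hij : i < j) (hkl : k < l)
    {R T : ℕ} {a b : ZdEdge d} (ha : a = (y, k) ∨ a = (y + Pi.single l 1, k))
    (hb : b = (y + Pi.single k 1, l) ∨ b = (y, l)) (haL : a ∈ loopEdges x i j R T) (hbL : b ∈ loopEdges x i j R T) :
    k = i ∧ l = j ∧ (y = x ∨ y = x + Pi.single i ((R : ℤ) - 1) ∨ y = x + Pi.single j ((T : ℤ) - 1) ∨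
      y = x + Pi.single i ((R : ℤ) - 1) + Pi.single j ((T : ℤ) - 1)) := by
  have hij' : i ≠ j := ne_of_lt hij
  have hkl' : k ≠ l := ne_of_lt hkl
  -- directions: `a` is a `k`-link, `b` an `l`-link of the loop, so `{k, l} ⊆ {i, j}`; with `k < l`, `i < j`: `k = i`, `l = j`
  have hka : a.2 = k := by rcases ha with rfl | rfl <;> rfl
  have hlb : b.2 = l := by rcases hb with rfl | rfl <;> rfl
  obtain ⟨za, rfl⟩ : ∃ z, a = (z, k) := ⟨a.1, by ext <;> simp [hka]⟩
  obtain ⟨zb, rfl⟩ : ∃ z, b = (z, l) := ⟨b.1, by ext <;> simp [hlb]⟩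
  have hA := coords_of_mem_loopEdges' hij' haL
  have hB := coords_of_mem_loopEdges' hij' hbL
  have hk : k = i ∨ k = j := by rcases hA with ⟨h, -⟩ | ⟨h, -⟩ <;> simp [h]
  have hl : l = i ∨ l = j := by rcases hB with ⟨h, -⟩ | ⟨h, -⟩ <;> simp [h]
  have hki : k = i := by
    rcases hk with h | h
    · exact h
    · rcases hl with h' | h'
      · exact absurd (h ▸ h' ▸ hkl) (lt_asymm hij)
      · exact absurd (h.trans h'.symm) hkl'
  have hlj : l = j := by
    rcases hl with h' | h'
    · exact absurd (hki.trans h'.symm) hkl'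
    · exact h'
  subst hki; subst hlj
  refine ⟨rfl, rfl, ?_⟩
  -- coordinates of `y`: from the `k`-link (`= i`-link) and the `l`-link (`= j`-link)
  rcases hA with ⟨-, hAoff, hAj, hAi1, hAi2⟩ | ⟨h, -⟩
  swap; · exact absurd h hij'
  rcases hB with ⟨h, -⟩ | ⟨-, hBoff, hBi, hBj1, hBj2⟩
  · exact absurd h.symm hij'
  simp only [Prod.mk.injEq, and_true] at ha hb
  have za_off : ∀ l', l' ≠ l → za l' = y l' := fun l' h => by rcases ha with h' | h' <;> simp [h', h]
  have za_l : za l = y l ∨ za l = y l + 1 := by rcases ha with h' | h' <;> simp [h']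
  have zb_off : ∀ l', l' ≠ k → zb l' = y l' := fun l' h => by rcases hb with h' | h' <;> simp [h', h]
  have zb_k : zb k = y k + 1 ∨ zb k = y k := by rcases hb with h' | h' <;> simp [h']
  have hyoff : ∀ l', l' ≠ k → l' ≠ l → y l' = x l' := fun l' h1 h2 => by rw [← za_off l' h2]; exact hAoff l' h1 h2
  have e1 : zb l = y l := zb_off l hkl'.symm
  have e2 : za k = y k := za_off k hkl'
  have hyj : y l = x l ∨ y l = x l + ((T : ℤ) - 1) := by
    rw [e1] at hBj1 hBj2; rcases za_l with h | h <;> rw [h] at hAj <;> omega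
  have hyi : y k = x k ∨ y k = x k + ((R : ℤ) - 1) := by
    rw [e2] at hAi1 hAi2; rcases zb_k with h | h <;> rw [h] at hBi <;> omega
  -- assemble `y`
  have key : ∀ (ci cj : ℤ), y k = x k + ci → y l = x l + cj → y = x + Pi.single k ci + Pi.single l cj := by
    intro ci cj h1 h2
    ext l'
    by_cases h1' : l' = k
    · subst h1'; simp [hkl', h1]
    · by_cases h2' : l' = l
      · subst h2'; simp [h1', h2]
      · simp [h1', h2', hyoff l' h1' h2']
  rcases hyi with hi | hi <;> rcases hyj with hj | hj
  · exact Or.inl (by simpa using key 0 0 (by simpa using hi) (by simpa using hj))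
  · exact Or.inr (Or.inr (Or.inl (by simpa using key 0 _ (by simpa using hi) hj)))
  · exact Or.inr (Or.inl (by simpa using key _ 0 hi (by simpa using hj)))
  · exact Or.inr (Or.inr (Or.inr (key _ _ hi hj)))

/-- The loop's link set does not depend on the orientation: `loopEdges x i j R T = loopEdges x j i T R`. [folklore] -/
theorem loopEdges_comm (x : Literature.Probability.LatticeModels.Site d) (i j : Fin d) (R T : ℕ) :
    loopEdges x i j R T = loopEdges x j i T R := by
  ext e; simp only [loopEdges, Finset.mem_union]; tauto

/-- ★ **A plaquette holding two links of a loop with both sides `≥ 2` is one of the FOUR inner corner plaquettes** (`i < j`): it lies in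
the `(i, j)` plane with base point `x`, `x + (R−1)e_i`, `x + (T−1)e_j` or `x + (R−1)e_i + (T−1)e_j`. [folklore] -/
theorem mem_corners_of_two_le_card {x : Literature.Probability.LatticeModels.Site d} {i j : Fin d} (hij : i < j) {R T : ℕ}
    (hR : 2 ≤ R) (hT : 2 ≤ T) {q : ZdPlaquette d} (hq : 2 ≤ (plaquetteEdges q ∩ loopEdges x i j R T).card) :
    q ∈ (({x, x + Pi.single i ((R : ℤ) - 1), x + Pi.single j ((T : ℤ) - 1),
      x + Pi.single i ((R : ℤ) - 1) + Pi.single j ((T : ℤ) - 1)} : Finset _).image fun y => ((y, ⟨(i, j), hij⟩) : ZdPlaquette d)) := by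
  classical
  obtain ⟨y, ⟨⟨k, l⟩, hkl⟩⟩ := q
  have hkl' : k ≠ l := ne_of_lt hkl
  have hij' : i ≠ j := ne_of_lt hij
  set L := loopEdges x i j R T
  have hsplit : plaquetteEdges (y, ⟨(k, l), hkl⟩) =
      ({(y, k), (y + Pi.single l 1, k)} : Finset (ZdEdge d)) ∪ {(y + Pi.single k 1, l), (y, l)} := by
    ext e; simp [plaquetteEdges]; tauto
  have hA : (({(y, k), (y + Pi.single l 1, k)} : Finset (ZdEdge d)) ∩ L).card ≤ 1 := by
    refine Finset.card_le_one.2 fun a ha b hb => ?_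
    simp only [Finset.mem_inter, Finset.mem_insert, Finset.mem_singleton] at ha hb
    rcases ha with ⟨rfl | rfl, ha⟩ <;> rcases hb with ⟨rfl | rfl, hb⟩
    · rfl
    · exact (not_mem_loopEdges_parallel hij' hR hT hkl'.symm ha hb).elim
    · exact (not_mem_loopEdges_parallel hij' hR hT hkl'.symm hb ha).elim
    · rfl
  have hB : (({(y + Pi.single k 1, l), (y, l)} : Finset (ZdEdge d)) ∩ L).card ≤ 1 := by
    refine Finset.card_le_one.2 fun a ha b hb => ?_
    simp only [Finset.mem_inter, Finset.mem_insert, Finset.mem_singleton] at ha hb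
    rcases ha with ⟨rfl | rfl, ha⟩ <;> rcases hb with ⟨rfl | rfl, hb⟩
    · rfl
    · exact (not_mem_loopEdges_parallel hij' hR hT hkl' hb ha).elim
    · exact (not_mem_loopEdges_parallel hij' hR hT hkl' ha hb).elim
    · rfl
  rw [hsplit, Finset.union_inter_distrib_right] at hq
  have hsum := (Finset.card_union_le _ _).trans' hq
  have hA1 : (({(y, k), (y + Pi.single l 1, k)} : Finset (ZdEdge d)) ∩ L).Nonempty := by
    rw [← Finset.card_pos]; omega
  have hB1 : (({(y + Pi.single k 1, l), (y, l)} : Finset (ZdEdge d)) ∩ L).Nonempty := by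
    rw [← Finset.card_pos]; omega
  obtain ⟨a, ha⟩ := hA1
  obtain ⟨b, hb⟩ := hB1
  simp only [Finset.mem_inter, Finset.mem_insert, Finset.mem_singleton] at ha hb
  obtain ⟨hki, hlj, hy⟩ := base_mem_corners_of_two_links hij hkl ha.1 hb.1 ha.2 hb.2
  subst hki; subst hlj
  simp only [Finset.mem_image, Finset.mem_insert, Finset.mem_singleton]
  rcases hy with rfl | rfl | rfl | rfl
  · exact ⟨_, Or.inl rfl, rfl⟩
  · exact ⟨_, Or.inr (Or.inl rfl), rfl⟩
  · exact ⟨_, Or.inr (Or.inr (Or.inl rfl)), rfl⟩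
  · exact ⟨_, Or.inr (Or.inr (Or.inr rfl)), rfl⟩

/-- ★ **Counting with corners** (`i ≠ j`, `R, T ≥ 2`): `k` plaquettes cover at most `k + 4` links of the loop (each covers at most two, and only
the four inner corner plaquettes cover two), so `k + 4 < 2(R+T)` plaquettes leave a link of the `R × T` loop uncovered. [folklore] -/
theorem exists_mem_loopEdges_forall_not_mem_corners {x : Literature.Probability.LatticeModels.Site d} {i j : Fin d} (hij : i ≠ j)
    {R T : ℕ} (hR : 2 ≤ R) (hT : 2 ≤ T) {k : ℕ} (f : Fin k → ZdPlaquette d) (hk : k + 4 < 2 * (R + T)) :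
    ∃ e ∈ loopEdges x i j R T, ∀ l, e ∉ plaquetteEdges (f l) := by
  classical
  -- reduce to `i < j`
  wlog hlt : i < j generalizing i j R T
  · have h := this hij.symm hT hR (by omega) (lt_of_le_of_ne (not_lt.1 hlt) hij.symm)
    rwa [← loopEdges_comm] at h
  by_contra hcon
  push Not at hcon
  set L := loopEdges x i j R T with hL
  set S : Finset (ZdPlaquette d) := Finset.univ.image f with hS
  have hSk : S.card ≤ k := Finset.card_image_le.trans (by simp)
  have hsub : L ⊆ S.biUnion fun q => plaquetteEdges q ∩ L := fun e he => by
    obtain ⟨l, hl⟩ := hcon e he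
    exact Finset.mem_biUnion.2 ⟨f l, Finset.mem_image.2 ⟨l, Finset.mem_univ _, rfl⟩, Finset.mem_inter.2 ⟨hl, he⟩⟩
  set C : Finset (ZdPlaquette d) := (({x, x + Pi.single i ((R : ℤ) - 1), x + Pi.single j ((T : ℤ) - 1),
      x + Pi.single i ((R : ℤ) - 1) + Pi.single j ((T : ℤ) - 1)} : Finset _).image
        fun y => ((y, ⟨(i, j), hlt⟩) : ZdPlaquette d)) with hC
  have hC4 : C.card ≤ 4 := Finset.card_image_le.trans Finset.card_le_four
  have hg : ∀ q ∈ S, (plaquetteEdges q ∩ L).card ≤ 1 + (if q ∈ C then 1 else 0) := fun q _ => by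
    by_cases hqC : q ∈ C
    · simp only [hqC, if_true]; exact card_plaquetteEdges_inter_loopEdges_le_two hij hR hT q
    · simp only [hqC, if_false, add_zero]
      by_contra h
      exact hqC (mem_corners_of_two_le_card hlt hR hT (by change 2 ≤ (plaquetteEdges q ∩ L).card; omega))
  have h1 : L.card ≤ ∑ q ∈ S, (plaquetteEdges q ∩ L).card := (Finset.card_le_card hsub).trans Finset.card_biUnion_le
  have h2 : ∑ q ∈ S, (plaquetteEdges q ∩ L).card ≤ S.card + (S.filter (· ∈ C)).card := by
    refine (Finset.sum_le_sum hg).trans ?_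
    rw [Finset.sum_add_distrib, Finset.sum_const, smul_eq_mul, mul_one, Finset.card_filter]
  have h3 : (S.filter (· ∈ C)).card ≤ 4 :=
    (Finset.card_le_card (fun q hq => (Finset.mem_filter.1 hq).2)).trans hC4
  have h4 : L.card = 2 * (R + T) := card_loopEdges hij (by omega) (by omega)
  omega


/-! ### Thin loops -/


/-- **No plaquette holds all four links of a loop of area `≥ 2`**: for `i ≠ j` and `(R, T) ≠ (1, 1)` a plaquette contains at most three
links of the `R × T` loop (gen 15's `eq_one_of_plaquetteEdges_subset_loopEdges`). [folklore] -/
theorem card_plaquetteEdges_inter_loopEdges_le_three {x : Literature.Probability.LatticeModels.Site d} {i j : Fin d} (hij : i ≠ j)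
    {R T : ℕ} (hRT : ¬ (R = 1 ∧ T = 1)) (q : ZdPlaquette d) : (plaquetteEdges q ∩ loopEdges x i j R T).card ≤ 3 := by
  classical
  by_contra h
  have h4 : (plaquetteEdges q).card ≤ 4 := by unfold plaquetteEdges; exact Finset.card_le_four
  have heq : plaquetteEdges q ∩ loopEdges x i j R T = plaquetteEdges q :=
    Finset.eq_of_subset_of_card_le Finset.inter_subset_left (by omega)
  have hsub : plaquetteEdges q ⊆ loopEdges x i j R T := fun e he => (Finset.mem_inter.1 (heq.symm ▸ he)).2
  exact hRT (eq_one_of_plaquetteEdges_subset_loopEdges hij hsub)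

/-- ★ **A plaquette holding THREE links of the loop is an inner corner plaquette** (`i < j`; no side condition: three links among two
`k`-links and two `l`-links include one of each, `base_mem_corners_of_two_links`). [folklore] -/
theorem mem_corners_of_three_le_card {x : Literature.Probability.LatticeModels.Site d} {i j : Fin d} (hij : i < j) {R T : ℕ}
    {q : ZdPlaquette d} (hq : 3 ≤ (plaquetteEdges q ∩ loopEdges x i j R T).card) :
    q ∈ (({x, x + Pi.single i ((R : ℤ) - 1), x + Pi.single j ((T : ℤ) - 1),
      x + Pi.single i ((R : ℤ) - 1) + Pi.single j ((T : ℤ) - 1)} : Finset _).image fun y => ((y, ⟨(i, j), hij⟩) : ZdPlaquette d)) := by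
  classical
  obtain ⟨y, ⟨⟨k, l⟩, hkl⟩⟩ := q
  set L := loopEdges x i j R T
  have hsplit : plaquetteEdges (y, ⟨(k, l), hkl⟩) =
      ({(y, k), (y + Pi.single l 1, k)} : Finset (ZdEdge d)) ∪ {(y + Pi.single k 1, l), (y, l)} := by
    ext e; simp [plaquetteEdges]; tauto
  have hA : (({(y, k), (y + Pi.single l 1, k)} : Finset (ZdEdge d)) ∩ L).card ≤ 2 :=
    (Finset.card_le_card Finset.inter_subset_left).trans Finset.card_le_two
  have hB : (({(y + Pi.single k 1, l), (y, l)} : Finset (ZdEdge d)) ∩ L).card ≤ 2 :=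
    (Finset.card_le_card Finset.inter_subset_left).trans Finset.card_le_two
  rw [hsplit, Finset.union_inter_distrib_right] at hq
  have hsum := (Finset.card_union_le _ _).trans' hq
  have hA1 : (({(y, k), (y + Pi.single l 1, k)} : Finset (ZdEdge d)) ∩ L).Nonempty := by
    rw [← Finset.card_pos]; omega
  have hB1 : (({(y + Pi.single k 1, l), (y, l)} : Finset (ZdEdge d)) ∩ L).Nonempty := by
    rw [← Finset.card_pos]; omega
  obtain ⟨a, ha⟩ := hA1
  obtain ⟨b, hb⟩ := hB1
  simp only [Finset.mem_inter, Finset.mem_insert, Finset.mem_singleton] at ha hb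
  obtain ⟨hki, hlj, hy⟩ := base_mem_corners_of_two_links hij hkl ha.1 hb.1 ha.2 hb.2
  subst hki; subst hlj
  simp only [Finset.mem_image, Finset.mem_insert, Finset.mem_singleton]
  rcases hy with rfl | rfl | rfl | rfl
  · exact ⟨_, Or.inl rfl, rfl⟩
  · exact ⟨_, Or.inr (Or.inl rfl), rfl⟩
  · exact ⟨_, Or.inr (Or.inr (Or.inl rfl)), rfl⟩
  · exact ⟨_, Or.inr (Or.inr (Or.inr rfl)), rfl⟩

/-- ★ **Counting for thin loops** (`i ≠ j`, `R = 1` or `T = 1`, not both): the four inner corners collapse to TWO plaquettes (the two ends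
of the strip), the only ones holding three links; every other plaquette holds at most two. Hence `k` plaquettes cover at most `2k + 2` links,
and `k < R + T − 1` (= the area of the strip) plaquettes leave a link of the loop uncovered. [folklore] -/
theorem exists_mem_loopEdges_forall_not_mem_thin {x : Literature.Probability.LatticeModels.Site d} {i j : Fin d} (hij : i ≠ j)
    {R T : ℕ} (hthin : R = 1 ∨ T = 1) (hRT : ¬ (R = 1 ∧ T = 1)) {k : ℕ} (f : Fin k → ZdPlaquette d) (hk : k + 1 < R + T) :
    ∃ e ∈ loopEdges x i j R T, ∀ l, e ∉ plaquetteEdges (f l) := by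
  classical
  wlog hlt : i < j generalizing i j R T
  · have h := this hij.symm hthin.symm (fun h => hRT ⟨h.2, h.1⟩) (by omega) (lt_of_le_of_ne (not_lt.1 hlt) hij.symm)
    rwa [← loopEdges_comm] at h
  by_contra hcon
  push Not at hcon
  set L := loopEdges x i j R T with hL
  set S : Finset (ZdPlaquette d) := Finset.univ.image f with hS
  have hSk : S.card ≤ k := Finset.card_image_le.trans (by simp)
  have hsub : L ⊆ S.biUnion fun q => plaquetteEdges q ∩ L := fun e he => by
    obtain ⟨l, hl⟩ := hcon e he
    exact Finset.mem_biUnion.2 ⟨f l, Finset.mem_image.2 ⟨l, Finset.mem_univ _, rfl⟩, Finset.mem_inter.2 ⟨hl, he⟩⟩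
  set C : Finset (ZdPlaquette d) := (({x, x + Pi.single i ((R : ℤ) - 1), x + Pi.single j ((T : ℤ) - 1),
      x + Pi.single i ((R : ℤ) - 1) + Pi.single j ((T : ℤ) - 1)} : Finset _).image
        fun y => ((y, ⟨(i, j), hlt⟩) : ZdPlaquette d)) with hC
  have hC2 : C.card ≤ 2 := by
    rcases hthin with rfl | rfl
    · have e : (({x, x + Pi.single i (((1 : ℕ) : ℤ) - 1), x + Pi.single j ((T : ℤ) - 1),
          x + Pi.single i (((1 : ℕ) : ℤ) - 1) + Pi.single j ((T : ℤ) - 1)} : Finset _) : Finset _) =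
          {x, x + Pi.single j ((T : ℤ) - 1)} := by
        ext y; simp
      rw [hC, e]; exact Finset.card_image_le.trans Finset.card_le_two
    · have e : (({x, x + Pi.single i ((R : ℤ) - 1), x + Pi.single j (((1 : ℕ) : ℤ) - 1),
          x + Pi.single i ((R : ℤ) - 1) + Pi.single j (((1 : ℕ) : ℤ) - 1)} : Finset _) : Finset _) =
          {x, x + Pi.single i ((R : ℤ) - 1)} := by
        ext y; simp
      rw [hC, e]; exact Finset.card_image_le.trans Finset.card_le_two
  have hg : ∀ q ∈ S, (plaquetteEdges q ∩ L).card ≤ 2 + (if q ∈ C then 1 else 0) := fun q _ => by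
    by_cases hqC : q ∈ C
    · simp only [hqC, if_true]; exact card_plaquetteEdges_inter_loopEdges_le_three hij hRT q
    · simp only [hqC, if_false, add_zero]
      by_contra h
      exact hqC (mem_corners_of_three_le_card hlt (by change 3 ≤ (plaquetteEdges q ∩ L).card; omega))
  have h1 : L.card ≤ ∑ q ∈ S, (plaquetteEdges q ∩ L).card := (Finset.card_le_card hsub).trans Finset.card_biUnion_le
  have h2 : ∑ q ∈ S, (plaquetteEdges q ∩ L).card ≤ 2 * S.card + (S.filter (· ∈ C)).card := by
    refine (Finset.sum_le_sum hg).trans ?_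
    rw [Finset.sum_add_distrib, Finset.sum_const, smul_eq_mul, Finset.card_filter]; omega
  have h3 : (S.filter (· ∈ C)).card ≤ 2 :=
    (Finset.card_le_card (fun q hq => (Finset.mem_filter.1 hq).2)).trans hC2
  have h4 : L.card = 2 * (R + T) := card_loopEdges hij (by omega) (by omega)
  omega

end Geometry

end Summit.Ventures.YMGap.ZeroCouplingSlope
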